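import Literature.Geometry.MetricEmbeddings.HeisenbergSmearGradient
import HarnessLib

/-!
# Vertical control for the smearing on `ℍ(ℝ)`: `|∂ᵏ_v Ω| ≤ ∫ |F(h cᵗ) − F(h)| dh + C |∂_h Ω|`
for `t ∈ [k, k+1]`

Family `pnp`, layer `Literature/Geometry/MetricEmbeddings` (theorems only). Source: A. Naor,
R. Young, *Vertical perimeter versus horizontal perimeter*, Ann. of Math. 188 (2018) =
arXiv:1701.00620, §3.2 Lemma 3.6, second half of the proof (arXiv p. 23): "by arguing identically
to the proof of equation (64) in [LN14] […] for every `t ∈ ℕ` and `s ∈ [t, t+1]` we have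
`(Σ_h ‖f(hZᵗ) − f(h)‖^p)^{1/p} ≲ (∫ ‖Φ(hZˢ) − Φ(h)‖^p dh)^{1/p} + (Σ_h Σ_σ ‖f(hσ) − f(h)‖^p)^{1/p}`
(3.10)", after V. Lafforgue, A. Naor, arXiv:1212.2107 §3.3, (59)–(64): "let `U` be a bounded open set
such that `e ∈ U` yet `U ∩ xU = ∅` for all `x ∈ ℍ ∖ {e}` […] Fix `x ∈ ℍ` and `h ∈ xU`. Suppose that
`k ∈ ℕ` and `t ∈ [k, k+1]`. […] `F(hcᵗ) − f(xcᵏ) = Σ_w χ_w(hcᵗ)(f(w) − f(xcᵏ))` (60) […]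
`‖f(xcᵏ) − f(x)‖ ≲ ‖F(hcᵗ) − F(h)‖ + Σ_{z ∈ B_r} (‖f(xcᵏz) − f(xcᵏ)‖ + ‖f(xz) − f(x)‖)` (63).
Integration of (63) over `h ∈ xU` […] Since the sets `{xU}` are pairwise disjoint, summation […]
over `x ∈ ℍ`, combined with an application of Lemma 3.4, shows (64)".

Here `f = 𝟙_Ω`, `p = 1`, `k = 1`, `U` = the unit cell `[0,1)³` (whose left translates tile), `r = 30`.
PROVED:

* `abs_smear_sub_ind_le` — `|F(v) − 𝟙_Ω(x₀)| ≤ Σ_{w ∈ 𝓑_{30}} |𝟙_Ω(x₀w) − 𝟙_Ω(x₀)|` whenever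
  `x₀⁻¹v` lies in the stretched cell `[0,1)² × [0,2)` ((60)–(62));
* `abs_ind_center_sub_le` — the pointwise (63);
* `dispCount_center_le_integral` — the integrated form (64):
  `dispCount Ω cᵏ ≤ ∫ |F(h cᵗ) − F(h)| dh + 2·30·|𝓑_{30}|·|∂_h Ω|` for `t ∈ [k, k+1]`.

## References

* [NaorYoung2018] A. Naor, R. Young, Ann. of Math. 188 (2018) 171–279, §3.2 Lemma 3.6
  (arXiv:1701.00620 pp. 22–23; arXiv numbering).
-/

noncomputable section

open Finset
open scoped ContDiff

namespace Literature.Geometry.MetricEmbeddings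

/-! ### Vertical control -/

section Vertical

open _root_.MeasureTheory _root_.MeasureTheory.Measure

/-- If `χ_g(v) ≠ 0` then `g⁻¹v` lies in the closed box `[0,2]³`. [cite: NaorYoung2018, §3.2 Lemma 3.6] -/
theorem rel_of_bumpAt_ne_zero {g : ℤ × ℤ × ℤ} {v : ℝ × ℝ × ℝ} (h : bumpAt g v ≠ 0) :
    mulR (invR (castR g)) v ∈ Set.Icc (0 : ℝ) 2 ×ˢ (Set.Icc (0 : ℝ) 2 ×ˢ Set.Icc (0 : ℝ) 2) := by
  obtain ⟨⟨a1, a2⟩, ⟨b1, b2⟩, ⟨c1, c2⟩⟩ := bumpAt_ne_zero h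
  rw [mulR_invR_castR_apply]
  simp only [Set.mem_prod, Set.mem_Icc]
  exact ⟨⟨by linarith, by linarith⟩, ⟨by linarith, by linarith⟩, ⟨by nlinarith, by nlinarith⟩⟩

/-- **The smearing is close to the indicator on stretched cells** ([LN14, (61)–(62)] / [NY18, proof
of Lemma 3.6], for `f = 𝟙_Ω`): if `x₀⁻¹v ∈ [0,1)² × [0,2)` then
`|F(v) − 𝟙_Ω(x₀)| ≤ Σ_{w ∈ 𝓑_{30}} |𝟙_Ω(x₀ w) − 𝟙_Ω(x₀)|`
(`F(v) − 𝟙_Ω(x₀) = Σ_g χ_g(v) (𝟙_Ω(g) − 𝟙_Ω(x₀))`, `0 ≤ χ_g ≤ 1`, and `χ_g(v) ≠ 0` forces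
`x₀⁻¹g ∈ 𝓑_{30}`). [cite: NaorYoung2018, §3.2 Lemma 3.6] -/
theorem abs_smear_sub_ind_le (Ω : Finset (ℤ × ℤ × ℤ)) (v : ℝ × ℝ × ℝ) (x₀ : ℤ × ℤ × ℤ)
    (hx1 : 0 ≤ v.1 - x₀.1 ∧ v.1 - x₀.1 < 1) (hx2 : 0 ≤ v.2.1 - x₀.2.1 ∧ v.2.1 - x₀.2.1 < 1)
    (hx3 : 0 ≤ v.2.2 - x₀.2.2 - x₀.1 * (v.2.1 - x₀.2.1) ∧ v.2.2 - x₀.2.2 - x₀.1 * (v.2.1 - x₀.2.1) < 2) :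
    |smear Ω v - (if x₀ ∈ Ω then (1 : ℝ) else 0)| ≤
      ∑ w ∈ (wordBall_finite 30).toFinset,
        |(if heisMul x₀ w ∈ Ω then (1 : ℝ) else 0) - (if x₀ ∈ Ω then (1 : ℝ) else 0)| := by
  classical
  -- the window around `v`
  set K : ℕ := ⌈4 * (|v.1| + 3)⌉₊ with hK
  set gfun : ℕ × ℕ × ℕ → ℤ × ℤ × ℤ := fun ijk =>
    (⌊v.1⌋ - 2 + ijk.1, ⌊v.2.1⌋ - 2 + ijk.2.1, ⌊v.2.2⌋ - K - 3 + ijk.2.2) with hgfun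
  set I : Finset (ℕ × ℕ × ℕ) := Finset.range 4 ×ˢ (Finset.range 4 ×ˢ Finset.range (2 * K + 6)) with hI
  set W : Finset (ℤ × ℤ × ℤ) := I.image gfun with hW
  set ind : ℤ × ℤ × ℤ → ℝ := fun g => if g ∈ Ω then 1 else 0 with hind
  have h0 : |v.1 - v.1| < 1 := by simp
  have h0' : |v.2.1 - v.2.1| < 1 := by simp
  have h0'' : |v.2.2 - v.2.2| < 1 := by simp
  -- coverage and the partition identity at `v`
  have hcov : ∀ g, bumpAt g v ≠ 0 → g ∈ W := by
    intro g hg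
    obtain ⟨i, hi, j, hj, k, hk, hgeq⟩ := exists_window_index_of_bumpAt_ne_zero h0 h0' h0'' hg
    rw [hW, Finset.mem_image]
    exact ⟨(i, j, k), Finset.mem_product.mpr ⟨hi, Finset.mem_product.mpr ⟨hj, hk⟩⟩, hgeq.symm⟩
  have hinj : Set.InjOn gfun ↑I := by
    rintro ⟨i, j, k⟩ _ ⟨i', j', k'⟩ _ h
    simp only [hgfun, Prod.mk.injEq] at h
    obtain ⟨h1, h2, h3⟩ := h
    simp only [Prod.mk.injEq]
    refine ⟨?_, ?_, ?_⟩ <;> omega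
  have hWsum : ∑ g ∈ W, bumpAt g v = 1 := by
    rw [hW, Finset.sum_image hinj, hI, Finset.sum_product]
    simp_rw [Finset.sum_product]
    exact sum_bumpAt_window_near v v h0 h0' h0''
  -- `F(v) − 𝟙_Ω(x₀) = Σ_{g ∈ W} (𝟙_Ω(g) − 𝟙_Ω(x₀)) χ_g(v)`
  have hkey : smear Ω v - ind x₀ = ∑ g ∈ W, (ind g - ind x₀) * bumpAt g v := by
    have h1 : smear Ω v = ∑ g ∈ Ω ∩ W, bumpAt g v := by
      unfold smear
      symm
      refine Finset.sum_subset Finset.inter_subset_left fun g hg hg' => ?_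
      by_contra hne
      exact hg' (Finset.mem_inter.mpr ⟨hg, hcov g hne⟩)
    have h2 : ∑ g ∈ W, ind g * bumpAt g v = ∑ g ∈ Ω ∩ W, bumpAt g v := by
      rw [Finset.inter_comm, ← Finset.filter_mem_eq_inter, Finset.sum_filter]
      refine Finset.sum_congr rfl fun g _ => ?_
      simp only [hind]
      split_ifs <;> simp
    have h3 : ∑ g ∈ W, (ind g - ind x₀) * bumpAt g v =
        ∑ g ∈ W, ind g * bumpAt g v - ind x₀ * ∑ g ∈ W, bumpAt g v := by
      rw [Finset.mul_sum, ← Finset.sum_sub_distrib]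
      exact Finset.sum_congr rfl fun g _ => by ring
    rw [h3, h2, ← h1, hWsum, mul_one]
  -- bound term by term and reindex by `w = x₀⁻¹ g`
  set B := (wordBall_finite 30).toFinset with hB
  calc |smear Ω v - ind x₀| = |∑ g ∈ W, (ind g - ind x₀) * bumpAt g v| := by rw [hkey]
    _ ≤ ∑ g ∈ W, |ind g - ind x₀| * bumpAt g v := by
        refine (Finset.abs_sum_le_sum_abs _ _).trans (le_of_eq (Finset.sum_congr rfl fun g _ => ?_))
        rw [abs_mul, abs_of_nonneg (bumpAt_nonneg g v)]
    _ ≤ ∑ g ∈ W, |ind g - ind x₀| * (if bumpAt g v ≠ 0 then 1 else 0) := by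
        refine Finset.sum_le_sum fun g _ => mul_le_mul_of_nonneg_left ?_ (abs_nonneg _)
        split_ifs with h
        · exact bumpAt_le_one g v
        · rw [not_not] at h
          rw [h]
    _ = ∑ g ∈ W.filter (fun g => bumpAt g v ≠ 0), |ind g - ind x₀| := by
        rw [Finset.sum_filter]
        exact Finset.sum_congr rfl fun g _ => by split_ifs <;> simp
    _ ≤ ∑ w ∈ B, |ind (heisMul x₀ w) - ind x₀| := by
        set S := W.filter (fun g => bumpAt g v ≠ 0) with hS
        have hφ : Set.InjOn (fun g => heisMul (heisInv x₀) g) ↑S :=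
          fun g _ g' _ h => heisMul_right_injective (heisInv x₀) h
        have e1 : ∑ g ∈ S, |ind g - ind x₀| =
            ∑ w ∈ S.image (fun g => heisMul (heisInv x₀) g), |ind (heisMul x₀ w) - ind x₀| := by
          rw [Finset.sum_image hφ]
          exact Finset.sum_congr rfl fun g _ => by rw [heisMul_heisInv_cancel_left]
        rw [e1]
        refine Finset.sum_le_sum_of_subset_of_nonneg ?_ (fun w _ _ => abs_nonneg _)
        intro w hw
        rw [Finset.mem_image] at hw
        obtain ⟨g, hg, rfl⟩ := hw
        rw [hS, Finset.mem_filter] at hg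
        rw [hB, Set.Finite.mem_toFinset]
        exact heisInv_mul_mem_wordBall_of_rel hx1 hx2 hx3 (rel_of_bumpAt_ne_zero hg.2)

/-- **Pointwise vertical control** ([LN14, (63)]): for `x ∈ ℍ(ℤ)`, `u` in the cell `x·[0,1)³`,
`k ∈ ℕ` and `t ∈ [k, k+1]`,
`|𝟙_Ω(x cᵏ) − 𝟙_Ω(x)| ≤ |F(u cᵗ) − F(u)| + Σ_{w ∈ 𝓑_{30}} (|𝟙_Ω(xcᵏw) − 𝟙_Ω(xcᵏ)| + |𝟙_Ω(xw) − 𝟙_Ω(x)|)`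
(`u cᵗ = (u₁, u₂, u₃ + t)` lies in the stretched cell of `x cᵏ`).
[cite: NaorYoung2018, §3.2 Lemma 3.6] -/
theorem abs_ind_center_sub_le (Ω : Finset (ℤ × ℤ × ℤ)) (x : ℤ × ℤ × ℤ) (u : ℝ × ℝ × ℝ)
    (hu1 : 0 ≤ u.1 - x.1 ∧ u.1 - x.1 < 1) (hu2 : 0 ≤ u.2.1 - x.2.1 ∧ u.2.1 - x.2.1 < 1)
    (hu3 : 0 ≤ u.2.2 - x.2.2 - x.1 * (u.2.1 - x.2.1) ∧ u.2.2 - x.2.2 - x.1 * (u.2.1 - x.2.1) < 1)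
    (k : ℕ) {t : ℝ} (ht : (k : ℝ) ≤ t ∧ t ≤ k + 1) :
    |(if heisMul x (0, 0, (k : ℤ)) ∈ Ω then (1 : ℝ) else 0) - (if x ∈ Ω then (1 : ℝ) else 0)| ≤
      |smear Ω (u.1, u.2.1, u.2.2 + t) - smear Ω u| +
        ∑ w ∈ (wordBall_finite 30).toFinset,
          (|(if heisMul (heisMul x (0, 0, (k : ℤ))) w ∈ Ω then (1 : ℝ) else 0) -
              (if heisMul x (0, 0, (k : ℤ)) ∈ Ω then (1 : ℝ) else 0)| +
            |(if heisMul x w ∈ Ω then (1 : ℝ) else 0) - (if x ∈ Ω then (1 : ℝ) else 0)|) := by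
  have hxc : heisMul x (0, 0, (k : ℤ)) = (x.1, x.2.1, x.2.2 + k) := by
    obtain ⟨a, b, c⟩ := x
    simp [heisMul]
  -- the shifted point lies in the stretched cell of `x cᵏ`
  have h1 := abs_smear_sub_ind_le Ω (u.1, u.2.1, u.2.2 + t) (heisMul x (0, 0, (k : ℤ)))
    (by rw [hxc]; exact hu1) (by rw [hxc]; exact hu2)
    (by rw [hxc]; push_cast; constructor <;> nlinarith [hu3.1, hu3.2, ht.1, ht.2])
  have h2 := abs_smear_sub_ind_le Ω u x hu1 hu2 ⟨hu3.1, by linarith [hu3.2]⟩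
  rw [Finset.sum_add_distrib]
  -- triangle inequality
  have tri : ∀ a b c d : ℝ, |a - d| ≤ |b - a| + |b - c| + |c - d| := by
    intro a b c d
    calc |a - d| = |(-(b - a)) + ((b - c) + (c - d))| := by ring_nf
      _ ≤ |-(b - a)| + |(b - c) + (c - d)| := abs_add_le _ _
      _ ≤ |b - a| + (|b - c| + |c - d|) := by rw [abs_neg]; exact add_le_add le_rfl (abs_add_le _ _)
      _ = _ := by ring
  have h := tri (if heisMul x (0, 0, (k : ℤ)) ∈ Ω then (1 : ℝ) else 0)
    (smear Ω (u.1, u.2.1, u.2.2 + t)) (smear Ω u) (if x ∈ Ω then (1 : ℝ) else 0)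
  linarith [h1, h2, h]

/-- The vertical difference `u ↦ |F(u cᵗ) − F(u)|` is continuous. [cite: NaorYoung2018, §3.2 Lemma 3.6] -/
theorem continuous_smear_vdiff (Ω : Finset (ℤ × ℤ × ℤ)) (t : ℝ) :
    Continuous fun u : ℝ × ℝ × ℝ => |smear Ω (u.1, u.2.1, u.2.2 + t) - smear Ω u| := by
  have hc := (contDiff_smear Ω).continuous
  refine Continuous.abs (Continuous.sub ?_ hc)
  exact hc.comp (continuous_fst.prodMk ((continuous_fst.comp continuous_snd).prodMk
    ((continuous_snd.comp continuous_snd).add continuous_const)))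

/-- The vertical difference `u ↦ |F(u cᵗ) − F(u)|` has compact support.
[cite: NaorYoung2018, §3.2 Lemma 3.6] -/
theorem hasCompactSupport_smear_vdiff (Ω : Finset (ℤ × ℤ × ℤ)) (t : ℝ) :
    HasCompactSupport fun u : ℝ × ℝ × ℝ => |smear Ω (u.1, u.2.1, u.2.2 + t) - smear Ω u| := by
  have h1 : HasCompactSupport fun u : ℝ × ℝ × ℝ => smear Ω (u.1, u.2.1, u.2.2 + t) := by
    have h := (hasCompactSupport_smear Ω).comp_homeomorph (Homeomorph.addRight ((0 : ℝ), (0 : ℝ), t))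
    have e : (smear Ω ∘ (Homeomorph.addRight ((0 : ℝ), (0 : ℝ), t))) =
        fun u : ℝ × ℝ × ℝ => smear Ω (u.1, u.2.1, u.2.2 + t) := by
      funext u
      obtain ⟨u1, u2, u3⟩ := u
      simp only [Function.comp_apply, Homeomorph.coe_addRight, Prod.mk_add_mk, add_zero]
    rw [e] at h
    exact h
  exact (h1.sub (hasCompactSupport_smear Ω)).abs

/-- **Vertical control by integration over cells** ([LN14, (64)] / [NY18, (3.10)] for `f = 𝟙_Ω`,
`p = 1`, `k = 1`): for `k ∈ ℕ` and `t ∈ [k, k+1]`,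
`dispCount Ω cᵏ ≤ ∫_{ℍ(ℝ)} |F(h cᵗ) − F(h)| dh + 2 · 30·|𝓑_{30}| · |∂_h Ω|`
— integrate the pointwise control over the disjoint unit-volume cells `x·[0,1)³` and use the
discrete Poincaré-type lemma for the error terms. [cite: NaorYoung2018, §3.2 Lemma 3.6] -/
theorem dispCount_center_le_integral (Ω : Finset (ℤ × ℤ × ℤ)) (k : ℕ) {t : ℝ}
    (ht : (k : ℝ) ≤ t ∧ t ≤ k + 1) :
    (dispCount Ω (0, 0, (k : ℤ)) : ℝ) ≤
      (∫ u : ℝ × ℝ × ℝ, |smear Ω (u.1, u.2.1, u.2.2 + t) - smear Ω u|) +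
        2 * (30 * ((wordBall_finite 30).toFinset.card : ℝ) *
          (((Ω ×ˢ ({(1, 0, 0), (-1, 0, 0), (0, 1, 0), (0, -1, 0)} : Finset (ℤ × ℤ × ℤ))).filter
            fun p => heisMul p.1 p.2 ∉ Ω).card : ℝ)) := by
  classical
  set c : ℤ × ℤ × ℤ := (0, 0, (k : ℤ)) with hc
  set ind : ℤ × ℤ × ℤ → ℝ := fun g => if g ∈ Ω then 1 else 0 with hind
  set H : ℝ × ℝ × ℝ → ℝ := fun u => |smear Ω (u.1, u.2.1, u.2.2 + t) - smear Ω u| with hH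
  set B := (wordBall_finite 30).toFinset with hB
  set hper : ℝ := (((Ω ×ˢ ({(1, 0, 0), (-1, 0, 0), (0, 1, 0), (0, -1, 0)} :
    Finset (ℤ × ℤ × ℤ))).filter fun p => heisMul p.1 p.2 ∉ Ω).card : ℝ) with hhper
  set cell : ℤ × ℤ × ℤ → Set (ℝ × ℝ × ℝ) := fun y =>
    (mulR (invR (castR y))) ⁻¹' (Set.Ico (0 : ℝ) 1 ×ˢ (Set.Ico (0 : ℝ) 1 ×ˢ Set.Ico (0 : ℝ) 1))
    with hcell
  set R : ℤ × ℤ × ℤ → ℝ := fun x => ∑ w ∈ B,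
    (|ind (heisMul (heisMul x c) w) - ind (heisMul x c)| + |ind (heisMul x w) - ind x|) with hR
  have hHint : Integrable H :=
    (continuous_smear_vdiff Ω t).integrable_of_hasCompactSupport (hasCompactSupport_smear_vdiff Ω t)
  have hH0 : ∀ u, 0 ≤ H u := fun u => abs_nonneg _
  -- the finite set of `x` that can be displaced by `cᵏ`
  set X₀ : Finset (ℤ × ℤ × ℤ) := Ω ∪ Ω.image (fun x => heisMul x (heisInv c)) with hX₀
  -- (a) `dispCount ≤ Σ_{x ∈ X₀} |𝟙_Ω(x cᵏ) − 𝟙_Ω(x)|`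
  have ha : (dispCount Ω c : ℝ) ≤ ∑ x ∈ X₀, |ind (heisMul x c) - ind x| := by
    have hpt : ∀ x : ℤ × ℤ × ℤ, |ind (heisMul x c) - ind x| =
        (if x ∈ Ω ∧ heisMul x c ∉ Ω then (1 : ℝ) else 0) +
          (if x ∉ Ω ∧ heisMul x c ∈ Ω then (1 : ℝ) else 0) := by
      intro x
      simp only [hind]
      by_cases h1 : heisMul x c ∈ Ω <;> by_cases h2 : x ∈ Ω <;> simp [h1, h2]
    simp_rw [hpt]
    rw [Finset.sum_add_distrib, Finset.sum_boole, Finset.sum_boole, dispCount, Nat.cast_add]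
    refine add_le_add ?_ ?_
    · exact_mod_cast card_le_card fun y hy => by
        rw [mem_filter] at hy ⊢
        exact ⟨Finset.mem_union_left _ hy.1, hy.1, hy.2⟩
    · have h : (Ω.filter fun x => heisMul x (heisInv c) ∉ Ω).card ≤
          (X₀.filter fun x => x ∉ Ω ∧ heisMul x c ∈ Ω).card := by
        refine card_le_card_of_injOn (fun x => heisMul x (heisInv c)) (fun x hx => ?_)
          (fun x _ x' _ h => heisMul_left_injective (heisInv c) h)
        rw [mem_coe, mem_filter] at hx
        rw [mem_coe, mem_filter]
        refine ⟨Finset.mem_union_right _ (Finset.mem_image_of_mem _ hx.1), hx.2, ?_⟩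
        rw [heisMul_heisInv_heisMul]
        exact hx.1
      exact_mod_cast h
  -- (b) integrate the pointwise control over each cell
  have hb : ∀ x : ℤ × ℤ × ℤ, |ind (heisMul x c) - ind x| ≤ (∫ u in cell x, H u) + R x := by
    intro x
    have hvol : volume (cell x) = 1 := volume_cell x
    have hpt : ∀ u ∈ cell x, |ind (heisMul x c) - ind x| - R x ≤ H u := by
      intro u hu
      rw [hcell, mem_cell_iff] at hu
      have h := abs_ind_center_sub_le Ω x u hu.1 hu.2.1 hu.2.2 k ht
      simp only [hind, hR, hH, hc] at h ⊢
      linarith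
    have hmono := setIntegral_mono_on (μ := volume) (s := cell x)
      (f := fun _ => |ind (heisMul x c) - ind x| - R x) (g := H)
      (integrableOn_const (by rw [hvol]; exact ENNReal.one_ne_top)) hHint.integrableOn
      (measurableSet_cell x) hpt
    rw [setIntegral_const, measureReal_def, hvol, ENNReal.toReal_one, one_smul] at hmono
    linarith
  -- (c) sum over `x ∈ X₀`
  have hdisj : Set.Pairwise (↑X₀) (Function.onFun Disjoint cell) := by
    intro y _ y' _ hne
    rw [Function.onFun, Set.disjoint_left]
    intro u hu hu'
    rw [hcell, mem_cell_iff] at hu hu'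
    exact hne (cell_unique hu.1 hu.2.1 hu.2.2 hu'.1 hu'.2.1 hu'.2.2)
  have hcells : ∑ x ∈ X₀, ∫ u in cell x, H u ≤ ∫ u, H u := by
    rw [← integral_biUnion_finset X₀ (fun y _ => measurableSet_cell y) hdisj
      (fun y _ => hHint.integrableOn)]
    exact setIntegral_le_integral hHint (Filter.Eventually.of_forall hH0)
  have hRsum : ∑ x ∈ X₀, R x ≤ 2 * (30 * (B.card : ℝ) * hper) := by
    have hpo : ∑ w ∈ B, (dispCount Ω w : ℝ) ≤ 30 * (B.card : ℝ) * hper := by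
      have h := sum_dispCount_wordBall_le Ω 30
      rw [hB, hhper]
      exact_mod_cast h
    have hshift : ∑ x ∈ X₀, ∑ w ∈ B, |ind (heisMul (heisMul x c) w) - ind (heisMul x c)| ≤
        ∑ w ∈ B, (dispCount Ω w : ℝ) := by
      rw [Finset.sum_comm]
      refine Finset.sum_le_sum fun w _ => ?_
      have hφ : Set.InjOn (fun x => heisMul x c) ↑X₀ := fun x _ x' _ h => heisMul_left_injective c h
      have e : ∑ x ∈ X₀, |ind (heisMul (heisMul x c) w) - ind (heisMul x c)| =
          ∑ x' ∈ X₀.image (fun x => heisMul x c), |ind (heisMul x' w) - ind x'| := by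
        rw [Finset.sum_image hφ]
      rw [e]
      exact sum_abs_ind_sub_le_dispCount Ω _ w
    have hplain : ∑ x ∈ X₀, ∑ w ∈ B, |ind (heisMul x w) - ind x| ≤ ∑ w ∈ B, (dispCount Ω w : ℝ) := by
      rw [Finset.sum_comm]
      exact Finset.sum_le_sum fun w _ => sum_abs_ind_sub_le_dispCount Ω X₀ w
    have e : ∑ x ∈ X₀, R x = ∑ x ∈ X₀, ∑ w ∈ B, |ind (heisMul (heisMul x c) w) - ind (heisMul x c)| +
        ∑ x ∈ X₀, ∑ w ∈ B, |ind (heisMul x w) - ind x| := by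
      rw [← Finset.sum_add_distrib]
      exact Finset.sum_congr rfl fun x _ => Finset.sum_add_distrib
    rw [e]
    linarith
  calc (dispCount Ω c : ℝ) ≤ ∑ x ∈ X₀, |ind (heisMul x c) - ind x| := ha
    _ ≤ ∑ x ∈ X₀, ((∫ u in cell x, H u) + R x) := Finset.sum_le_sum fun x _ => hb x
    _ = (∑ x ∈ X₀, ∫ u in cell x, H u) + ∑ x ∈ X₀, R x := Finset.sum_add_distrib
    _ ≤ (∫ u, H u) + 2 * (30 * (B.card : ℝ) * hper) := add_le_add hcells hRsum

end Vertical

end Literature.Geometry.MetricEmbeddings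

end
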